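import Summits.QuantumFields.YangMills.Theorems.BalabanUVNodesN07AliasSumMargin
import Summits.QuantumFields.YangMills.Theorems.BalabanUVNodesN07AliasSumMarginSharpSmallL
import HarnessLib

/-!
# DAG node N07 (road R0′ at the record; the `hker` ∕ `hpos` letter) — THE SHARP ONE-LEVEL MARGIN, part 2 (the shifted grid):
# alternating cosecant sums, the paired partial-fraction identity, the Dirichlet-weight identity and the vanishing alias sums

Width seat `pub-ymgap-dag-n07-w7` (g5), `--supports stmt-QuantumFields-27364 --as helper`; count-neutral; 0 `def`.
Part 1 is `…N07AliasSumMarginSharpCore` (abstract core); part 3 (`…N07AliasSumMarginSharp`) assembles the sharp margin for every odd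
block side.  THIS FILE is the trigonometry, all on the SHIFTED GRID `x_n = α + nπ∕L` (`0 < α < π∕L`, odd `L = 2c+1`), in the letters
`ψ = Lα`, `y_j = sin² x_j` (points) and `Y_d = sin²(dπ∕L)` (nodes).

WHAT.  §5: `sum_range_shift_of_periodic` (full-period sums of an `L`-periodic sequence are shift-invariant), `sin_grid_ne_zero` (the grid
misses `πℤ`), `altCsc_periodic` ∕ `cot_periodic`; ★ `altCscSum_base` — the alternating aliasing identity `Σ_{m<L} (−1)^m∕sin x_m = L∕sin ψ`
(dag-n07-w5 g2's `sum_neg_one_pow_mul_sin_half_div` BY NAME, in grid letters), `altCscSum_shift` ∕ `altCscSum_reflect` (the same sum on the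
grid shifted by `j` steps, resp. reflected about `x_j`, equals `(−1)^j L∕sin ψ`); ★ `altCsc_paired` — the PAIRED partial fraction
`(−1)^j L∕sin ψ = 1∕sin x_j + sin x_j·Σ_{m<2c} (−1)^m cos((m+1)π∕L)∕(Y_{m+1} − y_j)`; ★ `dirichletWeight_sub_sq` — with the Dirichlet ∕ Lagrange
weight `ℓ_j = (−1)^j sin ψ∕(L sin x_j)`: `ℓ_j − ℓ_j² = (sin²ψ∕L²)·Σ_{m<2c} (−1)^m cos((m+1)π∕L)∕(Y_{m+1} − y_j)`; ★ `sum_inv_nodeSub_eq_zero` —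
the VANISHING ALIAS SUMS `Σ_{j<L} (Y_d − y_j)⁻¹ = 0` (`1 ≤ d ≤ c`; `cot(x−y) − cot(x+y) = sin 2y∕(sin²x − sin²y)` and both cotangent sums run
over a full period); `nodeSub_ne_zero`, `aliasAngle_eq_grid` (`(ϑ + 2πm)∕(2L) = ϑ∕(2L) + mπ∕L`).

HONEST SCOPE.  Elementary trigonometry on finite sums ([folklore] throughout); nothing of [B11]∕[B6]∕[3] is asserted; road items
(L2), (L4) and the multi-level `(P)_D` stay OPEN; `hker`, stub 1, K0⁷∕K1⁹ NOT closed; N07 not discharged; nothing continuum ∕ OS ∕ mass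
gap ∕ Clay.  Context: T. Bałaban, CMP **96** (1984) 223–250 [Balaban1984PropagatorsII] (2.22) p.226 — nothing is cited as a hypothesis.
-/

set_option autoImplicit false

noncomputable section

open Finset

namespace Summit.QuantumFields.YangMills.Theorems.N07AliasSumMarginSharp

open Summit.QuantumFields.YangMills.Theorems.N07AliasSumPositivity
open Summit.QuantumFields.YangMills.Theorems.N07AliasSumMargin

/-! ## §5  Trigonometric alias identities on the shifted grid `α + nπ∕L` -/

section Trig

open Real

/-- Sums over a full period of an `L`-periodic sequence are shift-invariant: `Σ_{m<L} f(m+j) = Σ_{m<L} f m`. [folklore] -/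
theorem sum_range_shift_of_periodic {f : ℕ → ℝ} {L : ℕ} (hf : ∀ n, f (n + L) = f n) (j : ℕ) :
    ∑ m ∈ range L, f (m + j) = ∑ m ∈ range L, f m := by
  induction j with
  | zero => simp
  | succ j ih =>
    have h1 : ∑ m ∈ range (L + 1), f (m + j) = (∑ m ∈ range L, f (m + 1 + j)) + f (0 + j) :=
      sum_range_succ' (fun m => f (m + j)) L
    have h2 : ∑ m ∈ range (L + 1), f (m + j) = (∑ m ∈ range L, f (m + j)) + f (L + j) :=
      sum_range_succ (fun m => f (m + j)) L
    have h3 : f (L + j) = f j := by rw [add_comm]; exact hf j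
    have e : ∀ m, f (m + (j + 1)) = f (m + 1 + j) := fun m => by rw [add_assoc, add_comm j 1]
    simp only [e]
    rw [zero_add] at h1
    linarith [ih]

/-- The shifted grid misses the zeros of the sine: for `0 < α < π∕L` and every `n : ℕ`, `sin(α + nπ∕L) ≠ 0`
(`α + nπ∕L = kπ` would make `αL∕π = kL − n` an integer strictly between `0` and `1`). [folklore] -/
theorem sin_grid_ne_zero {L : ℕ} (hL : 0 < L) {α : ℝ} (h0 : 0 < α) (h1 : α < π / L) (n : ℕ) :
    sin (α + n * (π / L)) ≠ 0 := by
  intro h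
  rw [sin_eq_zero_iff] at h
  obtain ⟨k, hk⟩ := h
  have hLr : (0 : ℝ) < L := by exact_mod_cast hL
  have hπL : 0 < π / L := div_pos pi_pos hLr
  have e1 : α = (k : ℝ) * π - n * (π / L) := by linarith
  have e2 : α / (π / L) = ((k * L - n : ℤ) : ℝ) := by
    push_cast
    rw [e1]
    field_simp
  have hlo : (0 : ℝ) < ((k * L - n : ℤ) : ℝ) := by rw [← e2]; exact div_pos h0 hπL
  have hhi : ((k * L - n : ℤ) : ℝ) < 1 := by rw [← e2]; exact (div_lt_one hπL).mpr h1
  have hlo' : (0 : ℤ) < k * L - n := by exact_mod_cast hlo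
  have hhi' : k * L - n < (1 : ℤ) := by exact_mod_cast hhi
  omega

/-- One grid period is `π`: `α + (n+L)π∕L = (α + nπ∕L) + π`. [folklore] -/
theorem grid_add_period {L : ℕ} (hL : 0 < L) (α : ℝ) (n : ℕ) :
    α + ((n + L : ℕ) : ℝ) * (π / L) = α + n * (π / L) + π := by
  have hLr : (L : ℝ) ≠ 0 := by exact_mod_cast hL.ne'
  push_cast
  field_simp
  ring

/-- The alternating cosecants on the grid are `L`-PERIODIC (odd `L`): with `Q n := (−1)^n ∕ sin(α + nπ∕L)`,
`Q (n+L) = Q n` (both the sign and the sine flip). [folklore] -/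
theorem altCsc_periodic {L : ℕ} (hL : Odd L) (α : ℝ) (n : ℕ) :
    (-1 : ℝ) ^ (n + L) / sin (α + ((n + L : ℕ) : ℝ) * (π / L)) = (-1 : ℝ) ^ n / sin (α + n * (π / L)) := by
  have hL0 : 0 < L := hL.pos
  rw [grid_add_period hL0, sin_add_pi, pow_add, hL.neg_one_pow]
  rw [mul_neg_one, neg_div_neg_eq]

/-- The cotangents on the grid are `L`-PERIODIC: `cos∕sin` at `α + (n+L)π∕L` equals `cos∕sin` at `α + nπ∕L`. [folklore] -/
theorem cot_periodic {L : ℕ} (hL : 0 < L) (α : ℝ) (n : ℕ) :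
    cos (α + ((n + L : ℕ) : ℝ) * (π / L)) / sin (α + ((n + L : ℕ) : ℝ) * (π / L))
      = cos (α + n * (π / L)) / sin (α + n * (π / L)) := by
  rw [grid_add_period hL, sin_add_pi, cos_add_pi, neg_div_neg_eq]

/-- ★ **The alternating aliasing identity at the base point** (dag-n07-w5 g2's `sum_neg_one_pow_mul_sin_half_div` at `ϑ = 2Lα`, in grid
letters): for odd `L` and `0 < α < π∕L`, `Σ_{m<L} (−1)^m ∕ sin(α + mπ∕L) = L ∕ sin(Lα)`. [folklore] -/
theorem altCscSum_base {L : ℕ} (hL : Odd L) {α : ℝ} (h0 : 0 < α) (h1 : α < π / L) :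
    ∑ m ∈ range L, (-1 : ℝ) ^ m / sin (α + m * (π / L)) = L / sin (L * α) := by
  obtain ⟨c, hc⟩ := hL
  have hL0 : 0 < L := by omega
  have hLr : (0 : ℝ) < L := by exact_mod_cast hL0
  have hLne : (L : ℝ) ≠ 0 := hLr.ne'
  have hπL : 0 < π / L := div_pos pi_pos hLr
  -- `ϑ := 2Lα ∈ (0, 2π)`
  have hϑ0 : 0 < 2 * L * α := by positivity
  have hLα : L * α < π := by have := (lt_div_iff₀ hLr).mp h1; linarith
  have hϑ1 : 2 * L * α < 2 * π := by linarith
  have h := sum_neg_one_pow_mul_sin_half_div c (L := L) (by omega) hϑ0 hϑ1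
  have eψ : 2 * L * α / 2 = L * α := by ring
  have earg : ∀ m : ℕ, (2 * L * α + 2 * π * m) / (2 * L) = α + m * (π / L) := by
    intro m; field_simp
  simp only [eψ, earg] at h
  have hsinψ : sin (L * α) ≠ 0 := (sin_pos_of_pos_of_lt_pi (by positivity) hLα).ne'
  set S : ℝ := sin (L * α) with hS
  have e : ∑ m ∈ range L, (-1 : ℝ) ^ m / sin (α + m * (π / L))
      = (L / S) * ∑ m ∈ range L, (-1 : ℝ) ^ m * S / (L * sin (α + m * (π / L))) := by
    rw [mul_sum]
    refine sum_congr rfl (fun m _ => ?_)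
    have hs := sin_grid_ne_zero hL0 h0 h1 m
    set sm : ℝ := sin (α + m * (π / L)) with hsm
    field_simp
  rw [e, h, mul_one]

/-- The alternating cosecant sum on the grid SHIFTED by `j` steps: `Σ_{m<L} (−1)^m ∕ sin(α + (m+j)π∕L) = (−1)^j · L ∕ sin(Lα)`
(periodicity `altCsc_periodic` and `sum_range_shift_of_periodic`). [folklore] -/
theorem altCscSum_shift {L : ℕ} (hL : Odd L) {α : ℝ} (h0 : 0 < α) (h1 : α < π / L) (j : ℕ) :
    ∑ m ∈ range L, (-1 : ℝ) ^ m / sin (α + ((m + j : ℕ) : ℝ) * (π / L)) = (-1 : ℝ) ^ j * (L / sin (L * α)) := by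
  set f : ℕ → ℝ := fun n => (-1 : ℝ) ^ n / sin (α + n * (π / L)) with hf
  have hper : ∀ n : ℕ, f (n + L) = f n := by
    intro n; simp only [hf]; exact altCsc_periodic hL α n
  have hshift := sum_range_shift_of_periodic hper j
  simp only [hf] at hshift
  rw [altCscSum_base hL h0 h1] at hshift
  rw [← hshift, mul_sum]
  refine sum_congr rfl (fun m _ => ?_)
  have hε : (-1 : ℝ) ^ j * (-1 : ℝ) ^ j = 1 := by rw [← pow_add, ← two_mul, pow_mul]; norm_num
  have e : (-1 : ℝ) ^ m = (-1 : ℝ) ^ j * (-1 : ℝ) ^ (m + j) := by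
    calc (-1 : ℝ) ^ m = (-1 : ℝ) ^ m * ((-1 : ℝ) ^ j * (-1 : ℝ) ^ j) := by rw [hε, mul_one]
      _ = (-1 : ℝ) ^ j * (-1 : ℝ) ^ (m + j) := by rw [pow_add]; ring
  rw [e, mul_div_assoc]

/-- The alternating cosecant sum on the grid REFLECTED about `α + jπ∕L`: `Σ_{m<L} (−1)^m ∕ sin(α + jπ∕L − mπ∕L) = (−1)^j · L ∕ sin(Lα)`
(reflect `m ↦ L−1−m`: `α + jπ∕L − (L−1−m)π∕L = α + (m+j+1)π∕L − π`, and `L − 1` is even). [folklore] -/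
theorem altCscSum_reflect {L : ℕ} (hL : Odd L) {α : ℝ} (h0 : 0 < α) (h1 : α < π / L) (j : ℕ) :
    ∑ m ∈ range L, (-1 : ℝ) ^ m / sin (α + j * (π / L) - m * (π / L)) = (-1 : ℝ) ^ j * (L / sin (L * α)) := by
  obtain ⟨c, hc⟩ := hL
  have hL0 : 0 < L := by omega
  have hLne : (L : ℝ) ≠ 0 := by exact_mod_cast hL0.ne'
  set f : ℕ → ℝ := fun m => (-1 : ℝ) ^ m / sin (α + j * (π / L) - m * (π / L)) with hf
  rw [← sum_range_reflect f L]
  have key : ∀ m ∈ range L, f (L - 1 - m)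
      = -((-1 : ℝ) ^ m / sin (α + ((m + (j + 1) : ℕ) : ℝ) * (π / L))) := by
    intro m hm
    rw [mem_range] at hm
    simp only [hf]
    have hcast : ((L - 1 - m : ℕ) : ℝ) = (L : ℝ) - 1 - m := by
      rw [Nat.cast_sub (by omega), Nat.cast_sub (by omega), Nat.cast_one]
    have earg : α + j * (π / L) - ((L - 1 - m : ℕ) : ℝ) * (π / L) = α + ((m + (j + 1) : ℕ) : ℝ) * (π / L) - π := by
      rw [hcast]; push_cast; field_simp; ring
    rw [earg, sin_sub_pi]
    have hsgn : (-1 : ℝ) ^ (L - 1 - m) = (-1 : ℝ) ^ m := by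
      have h1' : (-1 : ℝ) ^ (L - 1 - m) * (-1 : ℝ) ^ m = 1 := by
        rw [← pow_add, show L - 1 - m + m = 2 * c by omega, pow_mul]; norm_num
      have h2' : (-1 : ℝ) ^ m * (-1 : ℝ) ^ m = 1 := by
        rw [← pow_add, ← two_mul, pow_mul]; norm_num
      calc (-1 : ℝ) ^ (L - 1 - m) = (-1 : ℝ) ^ (L - 1 - m) * ((-1 : ℝ) ^ m * (-1 : ℝ) ^ m) := by rw [h2', mul_one]
        _ = ((-1 : ℝ) ^ (L - 1 - m) * (-1 : ℝ) ^ m) * (-1 : ℝ) ^ m := by ring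
        _ = (-1 : ℝ) ^ m := by rw [h1', one_mul]
    rw [hsgn, div_neg]
  rw [sum_congr rfl key, sum_neg_distrib, altCscSum_shift ⟨c, hc⟩ h0 h1 (j + 1), pow_succ]
  ring

/-- `sin(x+y)·sin(x−y) = sin² x − sin² y`. [folklore] -/
theorem sin_add_mul_sin_sub' (x y : ℝ) : sin (x + y) * sin (x - y) = sin x ^ 2 - sin y ^ 2 := by
  rw [sin_add, sin_sub]
  have hcx := cos_sq' x
  have hcy := cos_sq' y
  ring_nf
  rw [hcx, hcy]; ring

/-- The pair identity `1∕sin(x+y) + 1∕sin(x−y) = 2 sin x cos y ∕ (sin² x − sin² y)`. [folklore] -/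
theorem inv_sin_add_add_inv_sin_sub {x y : ℝ} (h1 : sin (x + y) ≠ 0) (h2 : sin (x - y) ≠ 0) :
    1 / sin (x + y) + 1 / sin (x - y) = 2 * sin x * cos y / (sin x ^ 2 - sin y ^ 2) := by
  have hsum : sin (x + y) + sin (x - y) = 2 * sin x * cos y := by rw [sin_add, sin_sub]; ring
  rw [div_add_div _ _ h1 h2, one_mul, mul_one, ← sin_add_mul_sin_sub' x y, add_comm, hsum]

/-- ★ **The alternating cosecant identity in PAIRED form on the grid.**  For odd `L = 2c+1`, `0 < α < π∕L` and `x_j = α + jπ∕L`: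
`(−1)^j · L ∕ sin(Lα) = 1∕sin x_j + sin x_j · Σ_{m<2c} (−1)^m cos((m+1)π∕L) ∕ (sin²((m+1)π∕L) − sin² x_j)`
(average of `altCscSum_shift` and `altCscSum_reflect`, pairs `±m` combined by `inv_sin_add_add_inv_sin_sub`). [folklore] -/
theorem altCsc_paired {c L : ℕ} (hcL : 2 * c + 1 = L) {α : ℝ} (h0 : 0 < α) (h1 : α < π / L) (j : ℕ) :
    (-1 : ℝ) ^ j * (L / sin (L * α)) = 1 / sin (α + j * (π / L))
      + sin (α + j * (π / L)) * ∑ m ∈ range (2 * c), (-1 : ℝ) ^ m * cos ((m + 1 : ℕ) * (π / L))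
          / (sin ((m + 1 : ℕ) * (π / L)) ^ 2 - sin (α + j * (π / L)) ^ 2) := by
  have hL : Odd L := ⟨c, hcL.symm⟩
  have hL0 : 0 < L := by omega
  have hLne : (L : ℝ) ≠ 0 := by exact_mod_cast hL0.ne'
  have hA := altCscSum_shift hL h0 h1 j
  have hB := altCscSum_reflect hL h0 h1 j
  set x : ℝ := α + j * (π / L) with hx
  -- the shifted sum in the letters `x + mπ∕L`
  have eA : ∑ m ∈ range L, (-1 : ℝ) ^ m / sin (α + ((m + j : ℕ) : ℝ) * (π / L))
      = ∑ m ∈ range L, (-1 : ℝ) ^ m / sin (x + m * (π / L)) := by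
    refine sum_congr rfl (fun m _ => ?_)
    rw [hx]; congr 2; push_cast; ring
  rw [eA] at hA
  -- add the two and split off `m = 0`
  have hsum : 2 * ((-1 : ℝ) ^ j * (L / sin (L * α)))
      = ∑ m ∈ range L, (-1 : ℝ) ^ m * (1 / sin (x + m * (π / L)) + 1 / sin (x - m * (π / L))) := by
    rw [two_mul]
    nth_rewrite 1 [← hA]
    rw [← hB, ← sum_add_distrib]
    refine sum_congr rfl (fun m _ => ?_)
    ring
  have hrange : range L = range (2 * c + 1) := by rw [hcL]
  rw [hrange, sum_range_succ'] at hsum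
  simp only [Nat.cast_zero, zero_mul, add_zero, sub_zero, pow_zero, one_mul] at hsum
  -- the pairs `m+1`
  have hpair : ∀ m ∈ range (2 * c), (-1 : ℝ) ^ (m + 1) * (1 / sin (x + ((m + 1 : ℕ) : ℝ) * (π / L))
        + 1 / sin (x - ((m + 1 : ℕ) : ℝ) * (π / L)))
      = 2 * (sin x * ((-1 : ℝ) ^ m * cos ((m + 1 : ℕ) * (π / L))
          / (sin ((m + 1 : ℕ) * (π / L)) ^ 2 - sin x ^ 2))) := by
    intro m hm
    rw [mem_range] at hm
    have hs1 : sin (x + ((m + 1 : ℕ) : ℝ) * (π / L)) ≠ 0 := by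
      have h := sin_grid_ne_zero hL0 h0 h1 (j + (m + 1))
      have e : x + ((m + 1 : ℕ) : ℝ) * (π / L) = α + ((j + (m + 1) : ℕ) : ℝ) * (π / L) := by
        rw [hx]; push_cast; ring
      rw [e]; exact h
    have hs2 : sin (x - ((m + 1 : ℕ) : ℝ) * (π / L)) ≠ 0 := by
      -- `x − (m+1)π∕L = (α + (j + L − (m+1))π∕L) − π`
      have h := sin_grid_ne_zero hL0 h0 h1 (j + (L - (m + 1)))
      have e : x - ((m + 1 : ℕ) : ℝ) * (π / L) = α + ((j + (L - (m + 1)) : ℕ) : ℝ) * (π / L) - π := by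
        rw [hx]; push_cast; rw [Nat.cast_sub (by omega)]; push_cast; field_simp; ring
      rw [e, sin_sub_pi, neg_ne_zero]; exact h
    rw [inv_sin_add_add_inv_sin_sub hs1 hs2, pow_succ]
    have hden : sin x ^ 2 - sin (((m + 1 : ℕ) : ℝ) * (π / L)) ^ 2
        = -(sin (((m + 1 : ℕ) : ℝ) * (π / L)) ^ 2 - sin x ^ 2) := by ring
    rw [hden, div_neg]
    ring
  rw [sum_congr rfl hpair] at hsum
  have hms : ∑ m ∈ range (2 * c), 2 * (sin x * ((-1 : ℝ) ^ m * cos ((m + 1 : ℕ) * (π / L))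
          / (sin ((m + 1 : ℕ) * (π / L)) ^ 2 - sin x ^ 2)))
      = 2 * (sin x * ∑ m ∈ range (2 * c), (-1 : ℝ) ^ m * cos ((m + 1 : ℕ) * (π / L))
          / (sin ((m + 1 : ℕ) * (π / L)) ^ 2 - sin x ^ 2)) := by
    rw [mul_sum, mul_sum]
  rw [hms] at hsum
  linarith

/-- ★ **The Dirichlet-weight identity** (pointwise, on the grid): with `ℓ_j := (−1)^j sin(Lα) ∕ (L sin x_j)` (the Lagrange ∕ Dirichlet
weight of the node `x_j = α + jπ∕L` at the off-grid point) and `Y_d = sin²(dπ∕L)`, `y_j = sin² x_j`: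
`ℓ_j − ℓ_j² = (sin²(Lα) ∕ L²) · Σ_{m<2c} (−1)^m cos((m+1)π∕L) ∕ (Y_{m+1} − y_j)` (`altCsc_paired` times `ℓ_j sin² x_j`). [folklore] -/
theorem dirichletWeight_sub_sq {c L : ℕ} (hcL : 2 * c + 1 = L) {α : ℝ} (h0 : 0 < α) (h1 : α < π / L) (j : ℕ) :
    (-1 : ℝ) ^ j * sin (L * α) / (L * sin (α + j * (π / L)))
        - ((-1 : ℝ) ^ j * sin (L * α) / (L * sin (α + j * (π / L)))) ^ 2
      = sin (L * α) ^ 2 / (L : ℝ) ^ 2 * ∑ m ∈ range (2 * c), (-1 : ℝ) ^ m * cos ((m + 1 : ℕ) * (π / L))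
          / (sin ((m + 1 : ℕ) * (π / L)) ^ 2 - sin (α + j * (π / L)) ^ 2) := by
  have hL0 : 0 < L := by omega
  have hLr : (0 : ℝ) < L := by exact_mod_cast hL0
  have hLne : (L : ℝ) ≠ 0 := hLr.ne'
  have hs : sin (α + j * (π / L)) ≠ 0 := sin_grid_ne_zero hL0 h0 h1 j
  have hψ : sin (L * α) ≠ 0 := by
    have hψπ : L * α < π := by have := (lt_div_iff₀ hLr).mp h1; linarith
    exact (sin_pos_of_pos_of_lt_pi (by positivity) hψπ).ne'
  have hPF := altCsc_paired hcL h0 h1 j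
  set T := ∑ m ∈ range (2 * c), (-1 : ℝ) ^ m * cos ((m + 1 : ℕ) * (π / L))
          / (sin ((m + 1 : ℕ) * (π / L)) ^ 2 - sin (α + j * (π / L)) ^ 2) with hT
  set s := sin (α + j * (π / L)) with hsdef
  set S := sin (L * α) with hSdef
  have hε : ((-1 : ℝ) ^ j) ^ 2 = 1 := by rw [← pow_mul, mul_comm, pow_mul]; norm_num
  -- from `ε L∕S = 1∕s + s T`: `T = (ε L∕S − 1∕s)∕s`
  have hT' : T = ((-1 : ℝ) ^ j * (L / S) - 1 / s) / s := by
    rw [eq_div_iff hs]; linarith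
  rw [hT', div_pow, mul_pow, hε, one_mul]
  field_simp

/-- ★ **Vanishing alias sums at the nodes**: for odd `L = 2c+1`, `0 < α < π∕L` and `1 ≤ d ≤ c`,
`Σ_{j<L} (sin²(dπ∕L) − sin²(α + jπ∕L))⁻¹ = 0` — `cot(x−y) − cot(x+y) = sin 2y ∕ (sin²x − sin²y)`, and the two cotangent sums are sums
over a full period of the same `L`-periodic sequence (`cot_periodic`, `sum_range_shift_of_periodic`). [folklore] -/
theorem sum_inv_nodeSub_eq_zero {c L : ℕ} (hcL : 2 * c + 1 = L) {α : ℝ} (h0 : 0 < α) (h1 : α < π / L) {d : ℕ}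
    (hd1 : 1 ≤ d) (hdc : d ≤ c) :
    ∑ j ∈ range L, (sin (d * (π / L)) ^ 2 - sin (α + j * (π / L)) ^ 2)⁻¹ = 0 := by
  have hL0 : 0 < L := by omega
  have hLr : (0 : ℝ) < L := by exact_mod_cast hL0
  have hLne : (L : ℝ) ≠ 0 := hLr.ne'
  have hπL : 0 < π / L := div_pos pi_pos hLr
  -- the periodic cotangent sequence
  set C : ℕ → ℝ := fun n => cos (α + n * (π / L)) / sin (α + n * (π / L)) with hC
  have hper : ∀ n, C (n + L) = C n := fun n => by simp only [hC]; exact cot_periodic hL0 α n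
  have hS1 := sum_range_shift_of_periodic hper (L - d)
  have hS2 := sum_range_shift_of_periodic hper d
  have hsin2 : sin (2 * (d * (π / L))) ≠ 0 := by
    have hlt : 2 * (d * (π / L)) < π := by
      have hd' : (2 * d : ℝ) < L := by exact_mod_cast (show 2 * d < L by omega)
      have h' : (2 * d : ℝ) * (π / L) < L * (π / L) := mul_lt_mul_of_pos_right hd' hπL
      have e : (L : ℝ) * (π / L) = π := by field_simp
      calc 2 * (d * (π / L)) = (2 * d : ℝ) * (π / L) := by ring
        _ < L * (π / L) := h'
        _ = π := e
    have hpos : 0 < 2 * (d * (π / L)) := by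
      have : (0 : ℝ) < d := by exact_mod_cast (show 0 < d by omega)
      positivity
    exact (sin_pos_of_pos_of_lt_pi hpos hlt).ne'
  -- termwise: `C(j + (L−d)) − C(j + d) = −sin(2dπ∕L) ∕ (Y_d − y_j)`
  have hterm : ∀ j ∈ range L, C (j + (L - d)) - C (j + d)
      = -(sin (2 * (d * (π / L))) * (sin (d * (π / L)) ^ 2 - sin (α + j * (π / L)) ^ 2)⁻¹) := by
    intro j _
    set x := α + j * (π / L) with hx
    set y := (d : ℝ) * (π / L) with hy
    have e1 : α + ((j + (L - d) : ℕ) : ℝ) * (π / L) = x - y + π := by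
      rw [hx, hy]; push_cast; rw [Nat.cast_sub (by omega)]; field_simp; ring
    have e2 : α + ((j + d : ℕ) : ℝ) * (π / L) = x + y := by rw [hx, hy]; push_cast; ring
    simp only [hC]
    rw [e1, e2, sin_add_pi, cos_add_pi, neg_div_neg_eq]
    have hs1 : sin (x + y) ≠ 0 := by
      have h := sin_grid_ne_zero hL0 h0 h1 (j + d); rw [← e2]; exact h
    have hs2 : sin (x - y) ≠ 0 := by
      have h := sin_grid_ne_zero hL0 h0 h1 (j + (L - d))
      rw [e1, sin_add_pi, neg_ne_zero] at h; exact h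
    have hprod : sin (x + y) * sin (x - y) = sin x ^ 2 - sin y ^ 2 := sin_add_mul_sin_sub' x y
    rw [div_sub_div _ _ hs2 hs1]
    have hnum : cos (x - y) * sin (x + y) - sin (x - y) * cos (x + y) = sin (2 * y) := by
      have e : 2 * y = (x + y) - (x - y) := by ring
      rw [e, Real.sin_sub (x + y) (x - y)]; ring
    rw [hnum, mul_comm (sin (x - y)) (sin (x + y)), hprod]
    have e3 : sin x ^ 2 - sin y ^ 2 = -(sin y ^ 2 - sin x ^ 2) := by ring
    rw [e3, div_neg, div_eq_mul_inv]
  have hdiff : ∑ j ∈ range L, (C (j + (L - d)) - C (j + d)) = 0 := by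
    rw [sum_sub_distrib, hS1, hS2, sub_self]
  rw [sum_congr rfl hterm, sum_neg_distrib, ← mul_sum, neg_eq_zero, mul_eq_zero] at hdiff
  rcases hdiff with h | h
  · exact absurd h hsin2
  · exact h

/-- The node differences do not vanish on the shifted grid: `sin²(dπ∕L) − sin²(α + jπ∕L) ≠ 0` for `1 ≤ d < L`
(`= −sin(x_j + dπ∕L)·sin(x_j − dπ∕L)`, both factors off the zeros of the sine by `sin_grid_ne_zero`). [folklore] -/
theorem nodeSub_ne_zero {L : ℕ} {α : ℝ} (h0 : 0 < α) (h1 : α < π / L) {d : ℕ} (hd1 : 1 ≤ d) (hdL : d < L) (j : ℕ) :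
    sin (d * (π / L)) ^ 2 - sin (α + j * (π / L)) ^ 2 ≠ 0 := by
  have hL0 : 0 < L := by omega
  have hLne : (L : ℝ) ≠ 0 := by exact_mod_cast hL0.ne'
  set x := α + j * (π / L) with hx
  set y := (d : ℝ) * (π / L) with hy
  have e1 : α + ((j + (L - d) : ℕ) : ℝ) * (π / L) = x - y + π := by
    rw [hx, hy]; push_cast; rw [Nat.cast_sub hdL.le]; field_simp; ring
  have e2 : α + ((j + d : ℕ) : ℝ) * (π / L) = x + y := by rw [hx, hy]; push_cast; ring
  have hs1 : sin (x + y) ≠ 0 := by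
    have h := sin_grid_ne_zero hL0 h0 h1 (j + d); rw [← e2]; exact h
  have hs2 : sin (x - y) ≠ 0 := by
    have h := sin_grid_ne_zero hL0 h0 h1 (j + (L - d))
    rw [e1, sin_add_pi, neg_ne_zero] at h; exact h
  have hprod : sin (x + y) * sin (x - y) = sin x ^ 2 - sin y ^ 2 := sin_add_mul_sin_sub' x y
  intro h
  have : sin (x + y) * sin (x - y) = 0 := by rw [hprod]; linarith
  rcases mul_eq_zero.mp this with h' | h'
  · exact hs1 h'
  · exact hs2 h'

/-- The alias angles in grid letters: `(ϑ + 2πm)∕(2L) = ϑ∕(2L) + m·(π∕L)`. [folklore] -/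
theorem aliasAngle_eq_grid (ϑ : ℝ) {L : ℕ} (hL : 0 < L) (m : ℕ) :
    (ϑ + 2 * π * m) / (2 * L) = ϑ / (2 * L) + m * (π / L) := by
  have hLne : (L : ℝ) ≠ 0 := by exact_mod_cast hL.ne'
  field_simp

end Trig

end Summit.QuantumFields.YangMills.Theorems.N07AliasSumMarginSharp

end
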